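import Mathlib
import HarnessLib
import Literature.MathematicalPhysics.QuantumLattice.SchwartzFourierDensity
import Literature.MathematicalPhysics.QuantumLattice.SchwingerOSAxioms
import Summits.QuantumFields.YangMills.Theorems.PencilRigidityCurvatureKernelBoundChartDerivativeBoundsTensor

/-!
# `CurvatureKernelBound` — stub A2 support: cut-off plane waves and pure-derivative decay

Support file for crux `stmt-QuantumFields-11687` (`PencilRigidity.CurvatureKernelBound`), line
`sixteen-charts-analytic-kernel`, stub `TensorRegularity` (A2, pure analysis).  For a real inner
product space `V`, a frequency `a : V` and a Schwartz function `ψ`, the **cut-off plane wave** is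
`e_a ψ = SchwartzMap.smulLeftCLM ℂ (x ↦ 𝐞(-⟪a, x⟫)) ψ`, `𝐞(t) = e^{2πit}` (Mathlib's Fourier
character).  We prove:

* `hasTemperateGrowth_fourierChar_neg_inner`, `norm_iteratedFDeriv_fourierChar_neg_inner_le`:
  `x ↦ 𝐞(-⟪a, x⟫)` is smooth of temperate growth with `‖Dⁱ e_a(x)‖ ≤ (2π‖a‖)ⁱ`;
* `schwartzNorm_fourierChar_mul_le`: `|e_a ψ|_M ≤ (2π)^M (1 + ‖a‖)^M |ψ|_M` (Leibniz);
* `lineDerivOp_smulLeftCLM_fourierChar`: `∂_v (e_a ψ) = e_a (∂_v ψ) − 2πi⟪a, v⟫ e_a ψ`;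
* `pow_mul_norm_apply_planeWave_le`: if a linear functional `ℓ` satisfies
  `‖ℓ(∂_vⁿ (e_a ∂_vᵐ χ))‖ ≤ D` for `n + m ≤ N₁`, then `(2π|⟪a, v⟫|)^N ‖ℓ(e_a ∂_vᵐ χ)‖ ≤ 2^N D` for
  `N + m ≤ N₁` (induction on `N`, moving one derivative at a time onto `ℓ`);
* `PlaneWaveTensorDecay` (registered sub-goal): for a functional `Λ` on two-point test functions
  obeying pure-derivative bounds along `v` in either slot of a tensor, the values on tensors of
  cut-off plane waves decay: `(|⟪ξ, v⟫|^N + |⟪η, v⟫|^N) |Λ(e_ξ χ₁ ⊗ e_η χ₂)| ≤ 2 D(ξ, η)` with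
  `D` of polynomial growth of order `M₀` in `ξ`, `η`.
[folklore]
-/

noncomputable section

open scoped SchwartzMap FourierTransform RealInnerProductSpace LineDeriv ContDiff
open MeasureTheory Filter Set Real
open Literature.MathematicalPhysics.QuantumLattice

namespace Summit.QuantumFields.YangMills.Theorems.CurvatureKernel

/-! ## Plane waves `x ↦ 𝐞(-⟪a, x⟫)` -/

section PlaneWave

variable {V : Type*} [NormedAddCommGroup V] [InnerProductSpace ℝ V]

/-- The plane wave is the one-dimensional character composed with the linear form `-⟪a, ·⟫`. [folklore] -/
theorem fourierChar_neg_inner_eq_comp (a : V) :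
    (fun x : V => (𝐞 (-⟪a, x⟫) : ℂ)) = (fun t : ℝ => (𝐞 t : ℂ)) ∘ (-(innerSL ℝ a : V →L[ℝ] ℝ)) := by
  funext x
  simp [innerSL_apply_apply]

/-- The plane wave `x ↦ 𝐞(-⟪a, x⟫)` is smooth. [folklore] -/
theorem contDiff_fourierChar_neg_inner (a : V) {m : WithTop ℕ∞} :
    ContDiff ℝ m (fun x : V => (𝐞 (-⟪a, x⟫) : ℂ)) := by
  rw [fourierChar_neg_inner_eq_comp]
  exact contDiff_fourierChar.comp (-(innerSL ℝ a : V →L[ℝ] ℝ)).contDiff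

/-- **Derivative bound for plane waves**: `‖Dⁱ 𝐞(-⟪a, ·⟫)(x)‖ ≤ (2π‖a‖)ⁱ`. [folklore] -/
theorem norm_iteratedFDeriv_fourierChar_neg_inner_le (a : V) (i : ℕ) (x : V) :
    ‖iteratedFDeriv ℝ i (fun x : V => (𝐞 (-⟪a, x⟫) : ℂ)) x‖ ≤ (2 * π * ‖a‖) ^ i := by
  rw [fourierChar_neg_inner_eq_comp, (-(innerSL ℝ a : V →L[ℝ] ℝ)).iteratedFDeriv_comp_right
    contDiff_fourierChar x (i := i) (mod_cast le_top)]
  refine (ContinuousMultilinearMap.norm_compContinuousLinearMap_le _ _).trans ?_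
  rw [norm_iteratedFDeriv_fourierChar, Finset.prod_const, Finset.card_univ, Fintype.card_fin, norm_neg,
    innerSL_apply_norm]
  exact le_of_eq (by ring)

/-- `|𝐞(-⟪a, x⟫)| = 1`. [folklore] -/
theorem norm_fourierChar_neg_inner (a x : V) : ‖(𝐞 (-⟪a, x⟫) : ℂ)‖ = 1 :=
  Circle.norm_coe _

/-- The plane wave `x ↦ 𝐞(-⟪a, x⟫)` has temperate growth (all derivatives bounded). [folklore] -/
theorem hasTemperateGrowth_fourierChar_neg_inner (a : V) :
    Function.HasTemperateGrowth (fun x : V => (𝐞 (-⟪a, x⟫) : ℂ)) := by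
  refine ⟨contDiff_fourierChar_neg_inner a, fun n => ⟨0, (2 * π * ‖a‖) ^ n, fun x => ?_⟩⟩
  rw [pow_zero, mul_one]
  exact norm_iteratedFDeriv_fourierChar_neg_inner_le a n x

/-- Pointwise formula for the cut-off plane wave `e_a ψ`. [folklore] -/
theorem smulLeftCLM_fourierChar_apply (a : V) (ψ : 𝓢(V, ℂ)) (x : V) :
    SchwartzMap.smulLeftCLM ℂ (fun y : V => (𝐞 (-⟪a, y⟫) : ℂ)) ψ x = (𝐞 (-⟪a, x⟫) : ℂ) * ψ x := by
  rw [SchwartzMap.smulLeftCLM_apply_apply (hasTemperateGrowth_fourierChar_neg_inner a), smul_eq_mul]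

/-- The cut-off plane wave is supported in the support of the cut-off. [folklore] -/
theorem tsupport_smulLeftCLM_fourierChar_subset (a : V) (ψ : 𝓢(V, ℂ)) :
    tsupport (SchwartzMap.smulLeftCLM ℂ (fun y : V => (𝐞 (-⟪a, y⟫) : ℂ)) ψ : V → ℂ) ⊆ tsupport (ψ : V → ℂ) :=
  (SchwartzMap.tsupport_smulLeftCLM_subset _ ψ).trans inter_subset_left

/-- **Schwartz norms of cut-off plane waves grow polynomially in the frequency**:
`|e_a ψ|_M ≤ (2π)^M (1 + ‖a‖)^M |ψ|_M` (Leibniz rule with `‖Dⁱ e_a‖ ≤ (2π‖a‖)ⁱ`). [folklore] -/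
theorem schwartzNorm_fourierChar_mul_le (M : ℕ) (ψ : 𝓢(V, ℂ)) (a : V) (φ : 𝓢(V, ℂ))
    (hφ : ∀ x, φ x = (𝐞 (-⟪a, x⟫) : ℂ) * ψ x) :
    schwartzNorm M φ ≤ (2 * π) ^ M * (1 + ‖a‖) ^ M * schwartzNorm M ψ := by
  have h2π : (1 : ℝ) ≤ 2 * π := by nlinarith [Real.pi_gt_three]
  have hbase : 1 ≤ 2 * π * (1 + ‖a‖) := by nlinarith [norm_nonneg a]
  refine Seminorm.finset_sup_apply_le (mul_nonneg (by positivity) (schwartzNorm_nonneg _ _)) fun kn hkn => ?_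
  obtain ⟨hk, hn⟩ : kn.1 ≤ M ∧ kn.2 ≤ M := Prod.le_def.1 (Finset.mem_Iic.1 hkn)
  rw [SchwartzMap.schwartzSeminormFamily_apply]
  refine SchwartzMap.seminorm_le_bound ℂ kn.1 kn.2 φ (mul_nonneg (by positivity) (schwartzNorm_nonneg _ _))
    fun x => ?_
  have hcoe : (φ : V → ℂ) = fun y => ψ y * (𝐞 (-⟪a, y⟫) : ℂ) := funext fun y => by rw [hφ y, mul_comm]
  rw [hcoe]
  refine (pow_mul_norm_iteratedFDeriv_mul_le ψ (contDiff_fourierChar_neg_inner a)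
    (ε := fun j => (2 * π * ‖a‖) ^ j) (fun j _ y => norm_iteratedFDeriv_fourierChar_neg_inner_le a j y)
    kn.1 x).trans ?_
  calc ∑ j ∈ Finset.range (kn.2 + 1), (kn.2.choose j : ℝ) * SchwartzMap.seminorm ℂ kn.1 j ψ *
          (2 * π * ‖a‖) ^ (kn.2 - j)
      ≤ ∑ j ∈ Finset.range (kn.2 + 1), (kn.2.choose j : ℝ) * schwartzNorm M ψ * (2 * π * ‖a‖) ^ (kn.2 - j) := by
        gcongr with j hj
        exact seminorm_le_schwartzNorm hk ((Nat.lt_succ_iff.1 (Finset.mem_range.1 hj)).trans hn) ψ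
    _ = schwartzNorm M ψ * (1 + 2 * π * ‖a‖) ^ kn.2 := by
        rw [add_pow, Finset.mul_sum]
        refine Finset.sum_congr rfl fun j _ => ?_
        rw [one_pow, one_mul]
        ring
    _ ≤ schwartzNorm M ψ * (2 * π * (1 + ‖a‖)) ^ M := by
        gcongr
        · exact schwartzNorm_nonneg _ _
        calc (1 + 2 * π * ‖a‖) ^ kn.2 ≤ (2 * π * (1 + ‖a‖)) ^ kn.2 :=
              pow_le_pow_left₀ (by positivity) (by nlinarith [norm_nonneg a]) _
          _ ≤ (2 * π * (1 + ‖a‖)) ^ M := pow_le_pow_right₀ hbase hn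
    _ = (2 * π) ^ M * (1 + ‖a‖) ^ M * schwartzNorm M ψ := by rw [mul_pow]; ring

/-- **Line derivative of a cut-off plane wave**: `∂_v (e_a ψ) = e_a (∂_v ψ) − 2πi⟪a, v⟫ e_a ψ`. [folklore] -/
theorem lineDerivOp_smulLeftCLM_fourierChar (a v : V) (ψ : 𝓢(V, ℂ)) :
    (LineDeriv.lineDerivOp v (SchwartzMap.smulLeftCLM ℂ (fun y : V => (𝐞 (-⟪a, y⟫) : ℂ)) ψ) : 𝓢(V, ℂ)) =
      SchwartzMap.smulLeftCLM ℂ (fun y : V => (𝐞 (-⟪a, y⟫) : ℂ)) (LineDeriv.lineDerivOp v ψ) +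
        (-(2 * π * Complex.I * (⟪a, v⟫ : ℝ))) • SchwartzMap.smulLeftCLM ℂ (fun y : V => (𝐞 (-⟪a, y⟫) : ℂ)) ψ := by
  ext x
  have hdiff : DifferentiableAt ℝ (fun y : V => (𝐞 (-⟪a, y⟫) : ℂ)) x :=
    ((contDiff_fourierChar_neg_inner a (m := 1)).differentiable one_ne_zero) x
  have hderiv : fderiv ℝ (fun y : V => (𝐞 (-⟪a, y⟫) : ℂ)) x v =
      -2 * π * Complex.I * (⟪a, v⟫ : ℝ) * (𝐞 (-⟪a, x⟫) : ℂ) := by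
    have h := Real.fderiv_fourierChar_neg_bilinear_right_apply (innerSL ℝ) a x v
    exact h
  have hcoe : ⇑(SchwartzMap.smulLeftCLM ℂ (fun y : V => (𝐞 (-⟪a, y⟫) : ℂ)) ψ) =
      (fun y : V => (𝐞 (-⟪a, y⟫) : ℂ)) * ⇑ψ := funext fun y => smulLeftCLM_fourierChar_apply a ψ y
  rw [SchwartzMap.lineDerivOp_apply_eq_fderiv, hcoe, fderiv_mul hdiff ψ.differentiableAt]
  simp only [add_apply, smul_apply, smul_eq_mul, hderiv, smulLeftCLM_fourierChar_apply,
    SchwartzMap.lineDerivOp_apply_eq_fderiv]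
  ring

/-- **Pure-derivative control forces decay in the frequency, one direction.** If a linear
functional `ℓ` on `𝓢(V, ℂ)` satisfies `‖ℓ(∂_vⁿ (e_a ∂_vᵐ χ))‖ ≤ D` whenever `n + m ≤ N₁`, then
`(2π|⟪a, v⟫|)^N ‖ℓ(e_a ∂_vᵐ χ)‖ ≤ 2^N D` whenever `N + m ≤ N₁`: by `∂_v (e_a ψ) = e_a ∂_v ψ − 2πi⟪a,v⟫ e_a ψ`
one power of `⟪a, v⟫` is traded for one derivative falling either on `χ` or on `ℓ`, and both
resulting functionals again satisfy the hypothesis (induction on `N`). [folklore] -/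
theorem pow_mul_norm_apply_planeWave_le (a v : V) (χ : 𝓢(V, ℂ)) (D : ℝ) :
    ∀ (N : ℕ) (ℓ : 𝓢(V, ℂ) →ₗ[ℂ] ℂ) (N₁ : ℕ),
      (∀ n m : ℕ, n + m ≤ N₁ →
        ‖ℓ ((LineDeriv.lineDerivOp v : 𝓢(V, ℂ) → 𝓢(V, ℂ))^[n]
          (SchwartzMap.smulLeftCLM ℂ (fun y : V => (𝐞 (-⟪a, y⟫) : ℂ))
            ((LineDeriv.lineDerivOp v : 𝓢(V, ℂ) → 𝓢(V, ℂ))^[m] χ)))‖ ≤ D) →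
      ∀ m : ℕ, N + m ≤ N₁ →
        (2 * π * |⟪a, v⟫|) ^ N *
          ‖ℓ (SchwartzMap.smulLeftCLM ℂ (fun y : V => (𝐞 (-⟪a, y⟫) : ℂ))
            ((LineDeriv.lineDerivOp v : 𝓢(V, ℂ) → 𝓢(V, ℂ))^[m] χ))‖ ≤ 2 ^ N * D := by
  intro N
  induction N with
  | zero =>
    intro ℓ N₁ h m hm
    simpa using h 0 m (by simpa using hm)
  | succ N ih =>
    intro ℓ N₁ h m hm
    set Ma : 𝓢(V, ℂ) →L[ℂ] 𝓢(V, ℂ) := SchwartzMap.smulLeftCLM ℂ (fun y : V => (𝐞 (-⟪a, y⟫) : ℂ)) with hMa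
    set c : ℂ := -(2 * π * Complex.I * (⟪a, v⟫ : ℝ)) with hc
    have hnc : ‖c‖ = 2 * π * |⟪a, v⟫| := by
      rw [hc, norm_neg, norm_mul, norm_mul, norm_mul, Complex.norm_real, Complex.norm_I, Complex.norm_two,
        Complex.norm_real, Real.norm_of_nonneg Real.pi_pos.le, Real.norm_eq_abs, mul_one]
    set ψ : 𝓢(V, ℂ) := (LineDeriv.lineDerivOp v : 𝓢(V, ℂ) → 𝓢(V, ℂ))^[m] χ with hψ
    -- the key identity `c • e_a ψ = ∂_v (e_a ψ) - e_a (∂_v^{m+1} χ)`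
    have hkey : c • Ma ψ = (LineDeriv.lineDerivOp v (Ma ψ) : 𝓢(V, ℂ)) -
        Ma ((LineDeriv.lineDerivOp v : 𝓢(V, ℂ) → 𝓢(V, ℂ))^[m + 1] χ) := by
      rw [hMa, lineDerivOp_smulLeftCLM_fourierChar, Function.iterate_succ_apply', ← hψ, ← hc]
      abel
    have hℓ : c * ℓ (Ma ψ) = ℓ (LineDeriv.lineDerivOp v (Ma ψ)) -
        ℓ (Ma ((LineDeriv.lineDerivOp v : 𝓢(V, ℂ) → 𝓢(V, ℂ))^[m + 1] χ)) := by
      rw [← smul_eq_mul, ← map_smul, hkey, map_sub]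
    -- the functional `ℓ ∘ ∂_v` satisfies the hypothesis with budget `N₁ - 1`
    obtain ⟨N₁', rfl⟩ : ∃ N₁', N₁ = N₁' + 1 := ⟨N₁ - 1, by omega⟩
    set ℓ' : 𝓢(V, ℂ) →ₗ[ℂ] ℂ := ℓ ∘ₗ (LineDeriv.lineDerivOpCLM ℂ (𝓢(V, ℂ)) v).toLinearMap with hℓ'
    have hℓ'apply : ∀ φ : 𝓢(V, ℂ), ℓ' φ = ℓ (LineDeriv.lineDerivOp v φ) := fun φ => by
      simp [hℓ', LineDeriv.lineDerivOpCLM_apply]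
    have h' : ∀ n m' : ℕ, n + m' ≤ N₁' →
        ‖ℓ' ((LineDeriv.lineDerivOp v : 𝓢(V, ℂ) → 𝓢(V, ℂ))^[n]
          (Ma ((LineDeriv.lineDerivOp v : 𝓢(V, ℂ) → 𝓢(V, ℂ))^[m'] χ)))‖ ≤ D := by
      intro n m' hnm
      rw [hℓ'apply, ← Function.iterate_succ_apply' (LineDeriv.lineDerivOp v : 𝓢(V, ℂ) → 𝓢(V, ℂ)) n]
      exact h (n + 1) m' (by omega)
    have hA := ih ℓ' N₁' h' m (by omega)
    rw [hℓ'apply] at hA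
    have hB := ih ℓ (N₁' + 1) h (m + 1) (by omega)
    have hnorm : ‖c‖ * ‖ℓ (Ma ψ)‖ ≤ ‖ℓ (LineDeriv.lineDerivOp v (Ma ψ))‖ +
        ‖ℓ (Ma ((LineDeriv.lineDerivOp v : 𝓢(V, ℂ) → 𝓢(V, ℂ))^[m + 1] χ))‖ := by
      rw [← norm_mul, hℓ]
      exact norm_sub_le _ _
    calc (2 * π * |⟪a, v⟫|) ^ (N + 1) * ‖ℓ (Ma ψ)‖
        = (2 * π * |⟪a, v⟫|) ^ N * (‖c‖ * ‖ℓ (Ma ψ)‖) := by rw [hnc]; ring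
      _ ≤ (2 * π * |⟪a, v⟫|) ^ N * (‖ℓ (LineDeriv.lineDerivOp v (Ma ψ))‖ +
            ‖ℓ (Ma ((LineDeriv.lineDerivOp v : 𝓢(V, ℂ) → 𝓢(V, ℂ))^[m + 1] χ))‖) := by gcongr
      _ = (2 * π * |⟪a, v⟫|) ^ N * ‖ℓ (LineDeriv.lineDerivOp v (Ma ψ))‖ +
            (2 * π * |⟪a, v⟫|) ^ N * ‖ℓ (Ma ((LineDeriv.lineDerivOp v : 𝓢(V, ℂ) → 𝓢(V, ℂ))^[m + 1] χ))‖ :=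
          mul_add _ _ _
      _ ≤ 2 ^ N * D + 2 ^ N * D := add_le_add hA hB
      _ = 2 ^ (N + 1) * D := by ring

/-- From `(2π|x|)^N g ≤ 2^N D` to `|x|^N g ≤ D` (`2 ≤ 2π`). [folklore] -/
theorem abs_pow_mul_le_of_two_pi {x g D : ℝ} {N : ℕ} (hg : 0 ≤ g)
    (h : (2 * π * |x|) ^ N * g ≤ 2 ^ N * D) : |x| ^ N * g ≤ D := by
  have h2 : (2 : ℝ) ^ N * (|x| ^ N * g) ≤ (2 * π * |x|) ^ N * g := by
    rw [show (2 * π * |x|) ^ N * g = (2 * π) ^ N * (|x| ^ N * g) by ring]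
    gcongr
    nlinarith [Real.pi_gt_three]
  exact le_of_mul_le_mul_left (h2.trans h) (by positivity)

end PlaneWave

/-! ## Tensors of two cut-off plane waves -/

section Tensor

variable {E : Type*} [NormedAddCommGroup E] [InnerProductSpace ℝ E]

/-- Additivity of `f ⊗ g` in the first slot. [folklore] -/
theorem tensorFin_two_add_left (f₁ f₂ g : 𝓢(E, ℂ)) :
    SchwartzMap.tensorFin 2 ![f₁ + f₂, g] = SchwartzMap.tensorFin 2 ![f₁, g] + SchwartzMap.tensorFin 2 ![f₂, g] := by
  ext x
  simp only [tensorFin_two_eval, add_apply]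
  ring

/-- Additivity of `f ⊗ g` in the second slot. [folklore] -/
theorem tensorFin_two_add_right (f g₁ g₂ : 𝓢(E, ℂ)) :
    SchwartzMap.tensorFin 2 ![f, g₁ + g₂] = SchwartzMap.tensorFin 2 ![f, g₁] + SchwartzMap.tensorFin 2 ![f, g₂] := by
  ext x
  simp only [tensorFin_two_eval, add_apply]
  ring

/-- Cut-off plane waves built on derived cut-offs stay supported in the support of the cut-off. [folklore] -/
theorem tsupport_planeWave_iterate_subset (a v : E) (m : ℕ) (χ : 𝓢(E, ℂ)) :
    tsupport (SchwartzMap.smulLeftCLM ℂ (fun y : E => (𝐞 (-⟪a, y⟫) : ℂ))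
      ((LineDeriv.lineDerivOp v : 𝓢(E, ℂ) → 𝓢(E, ℂ))^[m] χ) : E → ℂ) ⊆ tsupport (χ : E → ℂ) :=
  (tsupport_smulLeftCLM_fourierChar_subset a _).trans (tsupport_iterate_lineDerivOp_subset v m χ)

/-- **Decay of a functional on tensors of cut-off plane waves from pure-derivative bounds.** If
`‖Λ(∂_vᴺ f ⊗ g)‖, ‖Λ(f ⊗ ∂_vᴺ g)‖ ≤ |f|_{M₀} |g|_{M₀}` for `N ≤ N₁` and `f`, `g` supported in `U`, `W`,
then for cut-offs `χ₁`, `χ₂` supported in `U`, `W` whose derived cut-offs `∂_vᵐ χᵢ`, `m ≤ N₁`, have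
`|·|_{M₀}`-norms at most `Sᵢ`, and all frequencies `ξ`, `η`,
`(|⟪ξ,v⟫|^N + |⟪η,v⟫|^N) ‖Λ(e_ξ χ₁ ⊗ e_η χ₂)‖ ≤ 2 (2π)^{2M₀} S₁ S₂ (1+‖ξ‖)^{M₀} (1+‖η‖)^{M₀}`. [folklore] -/
theorem abs_inner_pow_mul_norm_tensor_le (Λ : 𝓢((Fin 2 → E), ℂ) →L[ℂ] ℂ) {U W : Set E} {M₀ N₁ : ℕ} {v : E}
    (hΛ0 : ∀ N ≤ N₁, ∀ f g : 𝓢(E, ℂ), tsupport (f : E → ℂ) ⊆ U → tsupport (g : E → ℂ) ⊆ W →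
      ‖Λ (SchwartzMap.tensorFin 2 ![(LineDeriv.lineDerivOp v : 𝓢(E, ℂ) → 𝓢(E, ℂ))^[N] f, g])‖ ≤
        schwartzNorm M₀ f * schwartzNorm M₀ g)
    (hΛ1 : ∀ N ≤ N₁, ∀ f g : 𝓢(E, ℂ), tsupport (f : E → ℂ) ⊆ U → tsupport (g : E → ℂ) ⊆ W →
      ‖Λ (SchwartzMap.tensorFin 2 ![f, (LineDeriv.lineDerivOp v : 𝓢(E, ℂ) → 𝓢(E, ℂ))^[N] g])‖ ≤
        schwartzNorm M₀ f * schwartzNorm M₀ g)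
    {χ₁ χ₂ : 𝓢(E, ℂ)} (h₁ : tsupport (χ₁ : E → ℂ) ⊆ U) (h₂ : tsupport (χ₂ : E → ℂ) ⊆ W) {S₁ S₂ : ℝ}
    (hS₁ : ∀ m ≤ N₁, schwartzNorm M₀ ((LineDeriv.lineDerivOp v : 𝓢(E, ℂ) → 𝓢(E, ℂ))^[m] χ₁) ≤ S₁)
    (hS₂ : ∀ m ≤ N₁, schwartzNorm M₀ ((LineDeriv.lineDerivOp v : 𝓢(E, ℂ) → 𝓢(E, ℂ))^[m] χ₂) ≤ S₂)
    (ξ η : E) {N : ℕ} (hN : N ≤ N₁) :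
    (|⟪ξ, v⟫| ^ N + |⟪η, v⟫| ^ N) *
        ‖Λ (SchwartzMap.tensorFin 2 ![SchwartzMap.smulLeftCLM ℂ (fun y : E => (𝐞 (-⟪ξ, y⟫) : ℂ)) χ₁,
          SchwartzMap.smulLeftCLM ℂ (fun y : E => (𝐞 (-⟪η, y⟫) : ℂ)) χ₂])‖ ≤
      2 * (((2 * π) ^ M₀ * (1 + ‖ξ‖) ^ M₀ * S₁) * ((2 * π) ^ M₀ * (1 + ‖η‖) ^ M₀ * S₂)) := by
  set Mξ := SchwartzMap.smulLeftCLM ℂ (fun y : E => (𝐞 (-⟪ξ, y⟫) : ℂ)) with hMξ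
  set Mη := SchwartzMap.smulLeftCLM ℂ (fun y : E => (𝐞 (-⟪η, y⟫) : ℂ)) with hMη
  set D := ((2 * π) ^ M₀ * (1 + ‖ξ‖) ^ M₀ * S₁) * ((2 * π) ^ M₀ * (1 + ‖η‖) ^ M₀ * S₂) with hD
  have hS₁0 : 0 ≤ S₁ := (schwartzNorm_nonneg _ _).trans (hS₁ 0 (Nat.zero_le _))
  have hS₂0 : 0 ≤ S₂ := (schwartzNorm_nonneg _ _).trans (hS₂ 0 (Nat.zero_le _))
  set g := ‖Λ (SchwartzMap.tensorFin 2 ![Mξ χ₁, Mη χ₂])‖ with hg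
  -- Schwartz norms of the cut-off plane waves on derived cut-offs
  have hnormξ : ∀ m ≤ N₁, schwartzNorm M₀ (Mξ ((LineDeriv.lineDerivOp v : 𝓢(E, ℂ) → 𝓢(E, ℂ))^[m] χ₁)) ≤
      (2 * π) ^ M₀ * (1 + ‖ξ‖) ^ M₀ * S₁ := fun m hm =>
    (schwartzNorm_fourierChar_mul_le M₀ _ ξ _ (fun x => smulLeftCLM_fourierChar_apply ξ _ x)).trans
      (by gcongr; exact hS₁ m hm)
  have hnormη : ∀ m ≤ N₁, schwartzNorm M₀ (Mη ((LineDeriv.lineDerivOp v : 𝓢(E, ℂ) → 𝓢(E, ℂ))^[m] χ₂)) ≤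
      (2 * π) ^ M₀ * (1 + ‖η‖) ^ M₀ * S₂ := fun m hm =>
    (schwartzNorm_fourierChar_mul_le M₀ _ η _ (fun x => smulLeftCLM_fourierChar_apply η _ x)).trans
      (by gcongr; exact hS₂ m hm)
  have hnormξ0 : schwartzNorm M₀ (Mξ χ₁) ≤ (2 * π) ^ M₀ * (1 + ‖ξ‖) ^ M₀ * S₁ := by
    simpa using hnormξ 0 (Nat.zero_le _)
  have hnormη0 : schwartzNorm M₀ (Mη χ₂) ≤ (2 * π) ^ M₀ * (1 + ‖η‖) ^ M₀ * S₂ := by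
    simpa using hnormη 0 (Nat.zero_le _)
  -- slot 0
  have hslot0 : |⟪ξ, v⟫| ^ N * g ≤ D := by
    let ℓ : 𝓢(E, ℂ) →ₗ[ℂ] ℂ :=
      { toFun := fun f => Λ (SchwartzMap.tensorFin 2 ![f, Mη χ₂])
        map_add' := fun f₁ f₂ => by simp only [tensorFin_two_add_left, map_add]
        map_smul' := fun c f => by simp only [tensorFin_two_smul_left, map_smul, RingHom.id_apply] }
    have hℓ : ∀ f, ℓ f = Λ (SchwartzMap.tensorFin 2 ![f, Mη χ₂]) := fun f => rfl
    have hyp : ∀ n m : ℕ, n + m ≤ N₁ → ‖ℓ ((LineDeriv.lineDerivOp v : 𝓢(E, ℂ) → 𝓢(E, ℂ))^[n]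
        (Mξ ((LineDeriv.lineDerivOp v : 𝓢(E, ℂ) → 𝓢(E, ℂ))^[m] χ₁)))‖ ≤ D := by
      intro n m hnm
      rw [hℓ]
      refine (hΛ0 n (by omega) _ _ ((tsupport_planeWave_iterate_subset ξ v m χ₁).trans h₁)
        ((tsupport_smulLeftCLM_fourierChar_subset η χ₂).trans h₂)).trans ?_
      exact mul_le_mul (hnormξ m (by omega)) hnormη0 (schwartzNorm_nonneg _ _) (by positivity)
    have h := pow_mul_norm_apply_planeWave_le ξ v χ₁ D N ℓ N₁ hyp 0 (by simpa using hN)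
    rw [hℓ] at h
    simp only [Function.iterate_zero, id_eq] at h
    exact abs_pow_mul_le_of_two_pi (norm_nonneg _) h
  -- slot 1
  have hslot1 : |⟪η, v⟫| ^ N * g ≤ D := by
    let ℓ : 𝓢(E, ℂ) →ₗ[ℂ] ℂ :=
      { toFun := fun f => Λ (SchwartzMap.tensorFin 2 ![Mξ χ₁, f])
        map_add' := fun f₁ f₂ => by simp only [tensorFin_two_add_right, map_add]
        map_smul' := fun c f => by simp only [tensorFin_two_smul_right, map_smul, RingHom.id_apply] }
    have hℓ : ∀ f, ℓ f = Λ (SchwartzMap.tensorFin 2 ![Mξ χ₁, f]) := fun f => rfl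
    have hyp : ∀ n m : ℕ, n + m ≤ N₁ → ‖ℓ ((LineDeriv.lineDerivOp v : 𝓢(E, ℂ) → 𝓢(E, ℂ))^[n]
        (Mη ((LineDeriv.lineDerivOp v : 𝓢(E, ℂ) → 𝓢(E, ℂ))^[m] χ₂)))‖ ≤ D := by
      intro n m hnm
      rw [hℓ]
      refine (hΛ1 n (by omega) _ _ ((tsupport_smulLeftCLM_fourierChar_subset ξ χ₁).trans h₁)
        ((tsupport_planeWave_iterate_subset η v m χ₂).trans h₂)).trans ?_
      exact mul_le_mul hnormξ0 (hnormη m (by omega)) (schwartzNorm_nonneg _ _) (by positivity)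
    have h := pow_mul_norm_apply_planeWave_le η v χ₂ D N ℓ N₁ hyp 0 (by simpa using hN)
    rw [hℓ] at h
    simp only [Function.iterate_zero, id_eq] at h
    exact abs_pow_mul_le_of_two_pi (norm_nonneg _) h
  calc (|⟪ξ, v⟫| ^ N + |⟪η, v⟫| ^ N) * g = |⟪ξ, v⟫| ^ N * g + |⟪η, v⟫| ^ N * g := add_mul _ _ _
    _ ≤ D + D := add_le_add hslot0 hslot1
    _ = 2 * D := by ring

/-- **Sub-goal `PlaneWaveTensorDecay`** (helper for stub `TensorRegularity`): decay of a functional on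
tensors of cut-off plane waves `e_ξ χ₁ ⊗ e_η χ₂` from pure-derivative bounds along one direction `v`
in either slot; restatement of `abs_inner_pow_mul_norm_tensor_le`. [folklore] -/
theorem PlaneWaveTensorDecay : ∀ {E : Type*} [NormedAddCommGroup E] [InnerProductSpace ℝ E] (Λ : SchwartzMap (Fin 2 → E) ℂ →L[ℂ] ℂ) (U W : Set E) (M₀ N₁ : ℕ) (v : E), (∀ N ≤ N₁, ∀ f g : SchwartzMap E ℂ, tsupport (f : E → ℂ) ⊆ U → tsupport (g : E → ℂ) ⊆ W → ‖Λ (SchwartzMap.tensorFin 2 ![(LineDeriv.lineDerivOp v : SchwartzMap E ℂ → SchwartzMap E ℂ)^[N] f, g])‖ ≤ schwartzNorm M₀ f * schwartzNorm M₀ g) → (∀ N ≤ N₁, ∀ f g : SchwartzMap E ℂ, tsupport (f : E → ℂ) ⊆ U → tsupport (g : E → ℂ) ⊆ W → ‖Λ (SchwartzMap.tensorFin 2 ![f, (LineDeriv.lineDerivOp v : SchwartzMap E ℂ → SchwartzMap E ℂ)^[N] g])‖ ≤ schwartzNorm M₀ f * schwartzNorm M₀ g) → ∀ (χ₁ χ₂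 : SchwartzMap E ℂ), tsupport (χ₁ : E → ℂ) ⊆ U → tsupport (χ₂ : E → ℂ) ⊆ W → ∀ (S₁ S₂ : ℝ), (∀ m ≤ N₁, schwartzNorm M₀ ((LineDeriv.lineDerivOp v : SchwartzMap E ℂ → SchwartzMap E ℂ)^[m] χ₁) ≤ S₁) → (∀ m ≤ N₁, schwartzNorm M₀ ((LineDeriv.lineDerivOp v : SchwartzMap E ℂ → SchwartzMap E ℂ)^[m] χ₂) ≤ S₂) → ∀ (ξ η : E) (N : ℕ), N ≤ N₁ → (|inner ℝ ξ v| ^ N + |inner ℝ η v| ^ N) * ‖Λ (SchwartzMap.tensorFin 2 ![SchwartzMap.smulLeftCLM ℂ (fun y : E => ((Real.fourierChar (-(inner ℝ ξ y)) : Circle) : ℂ)) χ₁, SchwartzMap.smulLeftCLM ℂ (fun y : E => ((Real.fourierChar (-(inner ℝ η y)) : Circle) : ℂ)) χ₂])‖ ≤ 2 * (((2 * Real.pi) ^ M₀ * (1 + ‖ξ‖) ^ M₀ * S₁) * ((2 * Real.pi) ^ M₀ * (1 + ‖η‖) ^ M₀ * S₂)) := by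
  intro E _ _ Λ U W M₀ N₁ v hΛ0 hΛ1 χ₁ χ₂ h₁ h₂ S₁ S₂ hS₁ hS₂ ξ η N hN
  exact abs_inner_pow_mul_norm_tensor_le Λ hΛ0 hΛ1 h₁ h₂ hS₁ hS₂ ξ η hN

end Tensor

end Summit.QuantumFields.YangMills.Theorems.CurvatureKernel
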